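/-
Copyright (c) 2025 Kevin Buzzard. All rights reserved.
Released under Apache 2.0 license as described in the file LICENSE.
Authors: Kevin Buzzard, Salvatore Mercuri
-- (for the material from `FLT/Mathlib/Topology/Algebra/RestrictedProduct/Equiv.lean`)

Vendored into this tree (Lean v4.32.0 / Mathlib v4.32.0) from the FLT project,
ImperialCollegeLondon/FLT @ 071d16bb51e87165b4f4b5466f14051344bf426b (2026-08-18), Apache-2.0
[FLTProject2025]. Modifications: see the module docstring ("Provenance and modifications").
-/
import Mathlib.Algebra.Group.Submonoid.Units
import Mathlib.LinearAlgebra.DFinsupp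
import Mathlib.LinearAlgebra.Matrix.Defs
import Mathlib.Topology.Algebra.RestrictedProduct.Basic
import Literature.NumberTheory.AdelicBaseChange.TensorRestrictedProduct
import HarnessLib

/-!
# Restricted products: factorwise equivalences, products over fibres (`flatten`), products of factors, principal filters

Topic `NumberTheory/AdelicBaseChange` — file 9 of the ADELIC BASE-CHANGE PACKET (the FLT project's
proof of `L ⊗[K] K_v ≃ₐ[L] ∏_{w ∣ v} L_w`, `L ⊗[K] 𝔸_K^∞ ≃ₐ[L] 𝔸_L^∞`, `L ⊗[K] 𝔸_K ≃ₐ[L] 𝔸_L`,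
vendored module by module; Cassels–Fröhlich, *Algebraic Number Theory*, Ch. II §10, §14). Needs file 8.
The (algebraic) equivalences of restricted products that the finite-adele base change (file 12) is
assembled from:

* `Equiv/MulEquiv/AddEquiv/RingEquiv/LinearEquiv.restrictedProductCongrRight`: factorwise
  isomorphisms `φ i : R₁ i ≃ R₂ i` with `φ i (A₁ i) = A₂ i` eventually induce an isomorphism of
  restricted products (used with `B ⊗[A] K_v ≅ ∏_{w∣v} L_w`, file 6);
* `Equiv.restrictedProductProd`, `Equiv.restrictedProductPi` (finite products of factor families
  commute with `Πʳ`);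
* **`RestrictedProduct.flatten`/`flattenEquiv`/`flattenEquiv'`**: for a map of index sets `f : ι → ι₂`
  with `Tendsto f ℱ 𝒢` (cofinite: finite fibres), `Πʳ j, [Π_{i ∈ f⁻¹ j} G i, Π C i]_[𝒢] ≃ Πʳ i, [G i, C i]_[ℱ]`
  — regrouping `∏'_v ∏_{w∣v} L_w ≅ ∏'_w L_w = 𝔸_L^∞`;
* `principalEquivProd`/`principalMulEquivProd`/`principalLinearEquivProd`: over a principal filter
  `𝓟 S`, `Πʳ i, [R i, A i]_[𝓟 S] ≃ (Π i ∈ S, A i) × Π i ∉ S, R i`-type splittings.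

NOT vendored from this FLT file (unused by the base-change chain; some duplicate Mathlib/tree
statements — FLT-INVENTORY §11.4): `MulEquiv.restrictedProductUnits` (= Mathlib v4.32's
`RestrictedProduct.unitsEquiv`, RP-1), the index-change families `…restrictedProductCongrLeft(')`
and `…restrictedProductCongr` with `RingEquiv.restrictedProductCongr_bijOn_structureSubring` (RP-9,
no consumer here), `Equiv.restrictedProductMatrix` (RP-3). The tree's own regrouping
`Literature.Topology.Algebra.RestrictedProduct.regroupEquiv` (`RestrictedProduct/Regroup.lean`,
cofinite, group case) is the same mathematics as `flattenEquiv'` in the opposite orientation (RP-2);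
FLT's filter-general `flatten` API is kept because file 12 consumes it by name.

Everything is PROVED (definitions with bodies + lemmas); no named facts. The STATEMENTS are,
verbatim, those of the published FLT project, so every declaration carries the provenance tag
`[cite: FLTProject2025, <FLT file> · <FLT name>]` (the gate's cited-only rule for `Literature/`).

## Provenance and modifications (Apache-2.0 §4)

Lean source: `FLT/Mathlib/Topology/Algebra/RestrictedProduct/Equiv.lean` of ImperialCollegeLondon/FLT at
commit `071d16bb51e8` (branch `main`, 2026-08-18; Lean v4.34.0-rc1 / Mathlib `274ed6d6`), in its own
`section`. Modifications made here: (1) back-port to Mathlib v4.32.0: `module`/`public import`/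
`@[expose] public section` removed (nothing else needed); (2) the declarations listed above OMITTED;
(3) docstrings and provenance tags added to every declaration; the original copyright header is kept
above.
NAMESPACES (CONVENTIONS §2, reviews p318962/p319167): this file has no FLT root-level declarations (the
packet namespace `Literature.NumberTheory.AdelicBaseChange` is merely opened at the top, as in every
packet file); FLT's deliberate extensions of MATHLIB namespaces — here `Equiv`, `MulEquiv`/`AddEquiv`,
`RingEquiv`, `LinearEquiv`, `RestrictedProduct` — keep their absolute names for dot notation, and each
such docstring says so. Short names are FLT's throughout, so that the later files of the packet, and an
eventual Mathlib bump absorbing FLT's upstreaming, need no renaming; none of them exists in Mathlib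
v4.32.0 or in the tree.

## References
* K. Buzzard, R. Taylor et al., *FLT* (Lean 4 project), Imperial College London, 2025–. [FLTProject2025]
-/

namespace Literature.NumberTheory.AdelicBaseChange
-- the packet namespace (CONVENTIONS §2): FLT-root declarations below live in it; it is opened here so
-- that FLT's cross-references between them and its Mathlib-namespace extensions resolve unchanged.
end Literature.NumberTheory.AdelicBaseChange

open Literature.NumberTheory.AdelicBaseChange

/-! ## From `FLT/Mathlib/Topology/Algebra/RestrictedProduct/Equiv.lean` -/

section

--import Mathlib.Topology.Algebra.ContinuousMonoidHom

section

open RestrictedProduct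

section pi_congr_right

variable {ι : Type*}
variable {R₁ : ι → Type*} {R₂ : ι → Type*} {S₁ : ι → Type*} {S₂ : ι → Type*}
  [(i : ι) → SetLike (S₁ i) (R₁ i)] [(i : ι) → SetLike (S₂ i) (R₂ i)]
variable {A₁ : (i : ι) → Set (R₁ i)} {A₂ : (i : ι) → Set (R₂ i)}
variable {𝓕 : Filter ι}

/-- The equivalence between restricted products on the same index, when
each factor is equivalent, with compatibility on the restricted subsets.
(In Mathlib's namespace `Equiv`: a deliberate extension under FLT's name, for dot notation and so
that the later packet files apply unchanged — CONVENTIONS §2.)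
[cite: FLTProject2025, FLT/Mathlib/Topology/Algebra/RestrictedProduct/Equiv.lean · Equiv.restrictedProductCongrRight] -/
@[simps]
def Equiv.restrictedProductCongrRight (φ : (i : ι) → R₁ i ≃ R₂ i)
    (hφ : ∀ᶠ i in 𝓕, Set.BijOn (φ i) (A₁ i) (A₂ i)) :
    Πʳ i, [R₁ i, A₁ i]_[𝓕] ≃ Πʳ i, [R₂ i, A₂ i]_[𝓕] where
  toFun := map (fun i ↦ φ i) (by filter_upwards [hφ]; exact fun i ↦ Set.BijOn.mapsTo)
  invFun := map (fun i ↦ (φ i).symm)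
    (by filter_upwards [hφ]; exact fun i ↦ Set.BijOn.mapsTo ∘ Set.BijOn.equiv_symm)
  left_inv x := by ext; simp
  right_inv x := by ext; simp

section add_mul_equiv

variable [(i : ι) → Monoid (R₁ i)] [(i : ι) → Monoid (R₂ i)]
  [(i : ι) → SubmonoidClass (S₁ i) (R₁ i)] [(i : ι) → SubmonoidClass (S₂ i) (R₂ i)]
variable {A₁ : (i : ι) → S₁ i} {A₂ : (i : ι) → S₂ i}

/-- The `MulEquiv` between restricted products built from `MulEquiv`s on the factors.
(In Mathlib's namespace `MulEquiv`: a deliberate extension under FLT's name, for dot notation and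
so that the later packet files apply unchanged — CONVENTIONS §2.)
[cite: FLTProject2025, FLT/Mathlib/Topology/Algebra/RestrictedProduct/Equiv.lean · MulEquiv.restrictedProductCongrRight] -/
@[to_additive (attr := simps! apply) /-- The `AddEquiv` between restricted products built from
  `AddEquiv`s on the factors.
  (additive form; FLT's `AddEquiv.restrictedProductCongrRight`, same file) -/]
def MulEquiv.restrictedProductCongrRight (φ : (i : ι) → R₁ i ≃* R₂ i)
    (hφ : ∀ᶠ i in 𝓕, Set.BijOn (φ i) (A₁ i) (A₂ i)) :
    (Πʳ i, [R₁ i, A₁ i]_[𝓕]) ≃* (Πʳ i, [R₂ i, A₂ i]_[𝓕]) where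
  __ := Equiv.restrictedProductCongrRight _ hφ
  map_mul' _ _ := by ext; simp

end add_mul_equiv

section ring_equiv

variable [(i : ι) → Semiring (R₁ i)] [(i : ι) → Semiring (R₂ i)]
  [(i : ι) → SubsemiringClass (S₁ i) (R₁ i)] [(i : ι) → SubsemiringClass (S₂ i) (R₂ i)]
variable {A₁ : (i : ι) → S₁ i} {A₂ : (i : ι) → S₂ i}

/-- The ring isomorphism between restricted products on the same index, when
each factor is equivalent, with compatibility on the restricted subsets.
(In Mathlib's namespace `RingEquiv`: a deliberate extension under FLT's name, for dot notation and
so that the later packet files apply unchanged — CONVENTIONS §2.)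
[cite: FLTProject2025, FLT/Mathlib/Topology/Algebra/RestrictedProduct/Equiv.lean · RingEquiv.restrictedProductCongrRight] -/
@[simps! apply]
def RingEquiv.restrictedProductCongrRight (φ : (i : ι) → R₁ i ≃+* R₂ i)
    (hφ : ∀ᶠ i in 𝓕, Set.BijOn (φ i) (A₁ i) (A₂ i)) :
    (Πʳ i, [R₁ i, A₁ i]_[𝓕]) ≃+* (Πʳ i, [R₂ i, A₂ i]_[𝓕]) where
  __ := AddEquiv.restrictedProductCongrRight (fun _ ↦ (φ _).toAddEquiv) hφ
  map_mul' _ _ := by ext; simp [AddEquiv.restrictedProductCongrRight]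

end ring_equiv

section linear_equiv

variable {T : Type*} [Semiring T]
variable [(i : ι) → AddCommMonoid (R₁ i)] [(i : ι) → AddCommMonoid (R₂ i)]
variable [(i : ι) → Module T (R₁ i)] [(i : ι) → Module T (R₂ i)]
variable [(i : ι) → AddSubmonoidClass (S₁ i) (R₁ i)] [(i : ι) → AddSubmonoidClass (S₂ i) (R₂ i)]
variable {A₁ : (i : ι) → S₁ i} {A₂ : (i : ι) → S₂ i}
variable [(i : ι) → SMulMemClass (S₁ i) T (R₁ i)] [(i : ι) → SMulMemClass (S₂ i) T (R₂ i)]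

/-- The `LinearEquiv` between restricted products built from `LinearEquiv`s on the factors.
(In Mathlib's namespace `LinearEquiv`: a deliberate extension under FLT's name, for dot notation
and so that the later packet files apply unchanged — CONVENTIONS §2.)
[cite: FLTProject2025, FLT/Mathlib/Topology/Algebra/RestrictedProduct/Equiv.lean · LinearEquiv.restrictedProductCongrRight] -/
def LinearEquiv.restrictedProductCongrRight (φ : (i : ι) → R₁ i ≃ₗ[T] R₂ i)
    (hφ : ∀ᶠ i in 𝓕, Set.BijOn (φ i) (A₁ i) (A₂ i)) :
    (Πʳ i, [R₁ i, A₁ i]_[𝓕]) ≃ₗ[T] (Πʳ i, [R₂ i, A₂ i]_[𝓕]) where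
  __ := AddEquiv.restrictedProductCongrRight (fun i ↦ (φ i).toAddEquiv)
    (by filter_upwards [hφ]; exact fun i ↦ id)
  map_smul' m x := by
    ext i
    apply map_smul

end linear_equiv

end pi_congr_right

section binary

variable {ι : Type*} {ℱ : Filter ι} {A B : ι → Type*}
  {C : (i : ι) → Set (A i)} {D : (i : ι) → Set (B i)}

/-- The bijection between a restricted product of binary products, and the binary product
of the restricted products.
(In Mathlib's namespace `Equiv`: a deliberate extension under FLT's name, for dot notation and so
that the later packet files apply unchanged — CONVENTIONS §2.)
[cite: FLTProject2025, FLT/Mathlib/Topology/Algebra/RestrictedProduct/Equiv.lean · Equiv.restrictedProductProd] -/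
@[simps]
def Equiv.restrictedProductProd :
    Πʳ i, [A i × B i, C i ×ˢ D i]_[ℱ] ≃ (Πʳ i, [A i, C i]_[ℱ]) × (Πʳ i, [B i, D i]_[ℱ]) where
  toFun x := (map (fun i (t : A i × B i) ↦ t.1) (by simp +contextual [Set.MapsTo]) x,
              map (fun i (t : A i × B i) ↦ t.2) (by simp +contextual [Set.MapsTo]) x)
  invFun yz :=
    ⟨fun i ↦ (yz.1 i, yz.2 i), by
    filter_upwards [yz.1.2, yz.2.2] with i using Set.mk_mem_prod⟩
  left_inv x := by ext <;> rfl
  right_inv y := by ext <;> rfl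

/-- `Equiv.restrictedProductProd.symm` commutes with the inclusions along `ℱ₁ ≤ ℱ₂` (`rfl`).
(In Mathlib's namespace `Equiv`: a deliberate extension under FLT's name, for dot notation and so
that the later packet files apply unchanged — CONVENTIONS §2.)
[cite: FLTProject2025, FLT/Mathlib/Topology/Algebra/RestrictedProduct/Equiv.lean · Equiv.restrictedProductProd_symm_comp_inclusion] -/
lemma Equiv.restrictedProductProd_symm_comp_inclusion {ℱ₁ ℱ₂ : Filter ι} (hℱ : ℱ₁ ≤ ℱ₂) :
    Equiv.restrictedProductProd.symm ∘ Prod.map (inclusion _ _ hℱ) (inclusion _ _ hℱ) =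
      inclusion (fun i ↦ A i × B i) (fun i ↦ C i ×ˢ D i) hℱ ∘ Equiv.restrictedProductProd.symm :=
  rfl

end binary

section pi

variable {ι : Type*} {ℱ : Filter ι} {n : Type*} [Fintype n]
    {A : n → ι → Type*}
    {C : (j : n) → (i : ι) → Set (A j i)}

-- Q: Is there a mathlibism for `{f | ∀ j, f j ∈ C j i}`?
-- A: Yes, `Set.pi Set.univ`, except that it's defeq to `{f | ∀ j ∈ univ, f j ∈ C j i}`

/-- The bijection between a restricted product of finite products, and a finite product
of restricted products.
(In Mathlib's namespace `Equiv`: a deliberate extension under FLT's name, for dot notation and so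
that the later packet files apply unchanged — CONVENTIONS §2.)
[cite: FLTProject2025, FLT/Mathlib/Topology/Algebra/RestrictedProduct/Equiv.lean · Equiv.restrictedProductPi] -/
def Equiv.restrictedProductPi :
    Πʳ i, [Π j, A j i, {f | ∀ j, f j ∈ C j i}]_[ℱ] ≃ Π j, Πʳ i, [A j i, C j i]_[ℱ] where
  toFun x j := map (fun i t ↦ t _) (by simp +contextual [Set.MapsTo]) x
  invFun y := .mk (fun i j ↦ y j i) (by simp)
  left_inv x := by ext; rfl
  right_inv y := by ext; rfl

/-- `Equiv.restrictedProductPi.symm` commutes with the inclusions along `ℱ₁ ≤ ℱ₂` (`rfl`).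
(In Mathlib's namespace `Equiv`: a deliberate extension under FLT's name, for dot notation and so
that the later packet files apply unchanged — CONVENTIONS §2.)
[cite: FLTProject2025, FLT/Mathlib/Topology/Algebra/RestrictedProduct/Equiv.lean · Equiv.restrictedProductPi_symm_comp_inclusion] -/
lemma Equiv.restrictedProductPi_symm_comp_inclusion {ℱ₁ ℱ₂ : Filter ι} (hℱ : ℱ₁ ≤ ℱ₂) :
    Equiv.restrictedProductPi.symm ∘ Pi.map (fun i ↦ inclusion (A i) (C i) hℱ) =
      inclusion _ _ hℱ ∘ Equiv.restrictedProductPi.symm :=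
  rfl

end pi

namespace RestrictedProduct

section flatten

variable {ι : Type*}
variable {ℱ : Filter ι}
    {G H : ι → Type*}
    {C : (i : ι) → Set (G i)}
    {D : (i : ι) → Set (H i)}
variable {ι₂ : Type*} {𝒢 : Filter ι₂} {f : ι → ι₂} (C)

variable (hf : Filter.Tendsto f ℱ 𝒢) in
/-- The canonical map from a restricted product of products over fibres of a map on indexing sets
to the restricted product over the original indexing set.
(In Mathlib's namespace `RestrictedProduct`: a deliberate extension under FLT's name, for dot
notation and so that the later packet files apply unchanged — CONVENTIONS §2.)
[cite: FLTProject2025, FLT/Mathlib/Topology/Algebra/RestrictedProduct/Equiv.lean · RestrictedProduct.flatten] -/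
def flatten : Πʳ j, [Π (i : f ⁻¹' {j}), G i, Set.pi Set.univ (fun (i : f ⁻¹' {j}) => C i)]_[𝒢] →
    Πʳ i, [G i, C i]_[ℱ] :=
  mapAlong _ G f hf (fun i x ↦ x ⟨i, rfl⟩) (by filter_upwards with x y hy using hy ⟨x, rfl⟩ trivial)

/-- Components of `flatten`: `flatten C hf x i = x (f i) ⟨i, rfl⟩`.
(In Mathlib's namespace `RestrictedProduct`: a deliberate extension under FLT's name, for dot
notation and so that the later packet files apply unchanged — CONVENTIONS §2.)
[cite: FLTProject2025, FLT/Mathlib/Topology/Algebra/RestrictedProduct/Equiv.lean · RestrictedProduct.flatten_apply] -/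
@[simp]
lemma flatten_apply (hf : Filter.Tendsto f ℱ 𝒢) (x) (i : ι) :
    flatten C hf x i = x (f i) ⟨i, rfl⟩ :=
  rfl

variable (hf : Filter.comap f 𝒢 = ℱ)

/-- The canonical bijection from a restricted product of products over fibres of a map on indexing
sets to the restricted product over the original indexing set.
(In Mathlib's namespace `RestrictedProduct`: a deliberate extension under FLT's name, for dot
notation and so that the later packet files apply unchanged — CONVENTIONS §2.)
[cite: FLTProject2025, FLT/Mathlib/Topology/Algebra/RestrictedProduct/Equiv.lean · RestrictedProduct.flattenEquiv] -/
def flattenEquiv :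
    Πʳ j, [Π (i : f ⁻¹' {j}), G i, Set.pi Set.univ (fun (i : f ⁻¹' {j}) => C i)]_[𝒢] ≃
    Πʳ i, [G i, C i]_[ℱ] where
  toFun := flatten C (by rw [Filter.tendsto_iff_comap]; exact hf.ge)
  invFun := fun ⟨x, hx⟩ ↦ ⟨fun _ i ↦ x i, by
    rw [← hf, Filter.eventually_comap] at hx
    filter_upwards [hx] with j hj ⟨i, hi⟩ _ using hj i hi⟩
  left_inv := by
    intro ⟨x, hx⟩
    ext _ ⟨i, rfl⟩
    rfl
  right_inv x := by ext i; rfl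

/-- Components of `flattenEquiv`.
(In Mathlib's namespace `RestrictedProduct`: a deliberate extension under FLT's name, for dot
notation and so that the later packet files apply unchanged — CONVENTIONS §2.)
[cite: FLTProject2025, FLT/Mathlib/Topology/Algebra/RestrictedProduct/Equiv.lean · RestrictedProduct.flatten_equiv_apply] -/
@[simp]
lemma flatten_equiv_apply (x) (i : ι) :
    flattenEquiv C hf x i = x (f i) ⟨i, rfl⟩ :=
  rfl

/-- Components of `flattenEquiv.symm`.
(In Mathlib's namespace `RestrictedProduct`: a deliberate extension under FLT's name, for dot
notation and so that the later packet files apply unchanged — CONVENTIONS §2.)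
[cite: FLTProject2025, FLT/Mathlib/Topology/Algebra/RestrictedProduct/Equiv.lean · RestrictedProduct.flatten_equiv_symm_apply] -/
@[simp]
lemma flatten_equiv_symm_apply (x) (i : ι₂) (j : f ⁻¹' {i}) :
    (flattenEquiv C hf).symm x i j = x j.1 :=
  rfl

variable (hf : Filter.Tendsto f Filter.cofinite Filter.cofinite)

/-- The equivalence given by `flatten` when both restricted products are over the cofinite
filter.
(In Mathlib's namespace `RestrictedProduct`: a deliberate extension under FLT's name, for dot
notation and so that the later packet files apply unchanged — CONVENTIONS §2.)
[cite: FLTProject2025, FLT/Mathlib/Topology/Algebra/RestrictedProduct/Equiv.lean · RestrictedProduct.flattenEquiv'] -/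
def flattenEquiv' :
    Πʳ j, [Π (i : f ⁻¹' {j}), G i, Set.pi Set.univ (fun (i : f ⁻¹' {j}) => C i)] ≃
    Πʳ i, [G i, C i] :=
  flattenEquiv C <| le_antisymm (Filter.comap_cofinite_le f) (Filter.map_le_iff_le_comap.mp hf)

/-- Components of `flattenEquiv'` (the cofinite case).
(In Mathlib's namespace `RestrictedProduct`: a deliberate extension under FLT's name, for dot
notation and so that the later packet files apply unchanged — CONVENTIONS §2.)
[cite: FLTProject2025, FLT/Mathlib/Topology/Algebra/RestrictedProduct/Equiv.lean · RestrictedProduct.flatten_equiv'_apply] -/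
@[simp]
lemma flatten_equiv'_apply (x) (i : ι) :
    flattenEquiv' C hf x i = x (f i) ⟨i, rfl⟩ :=
  rfl

/-- Components of `(flattenEquiv').symm`.
(In Mathlib's namespace `RestrictedProduct`: a deliberate extension under FLT's name, for dot
notation and so that the later packet files apply unchanged — CONVENTIONS §2.)
[cite: FLTProject2025, FLT/Mathlib/Topology/Algebra/RestrictedProduct/Equiv.lean · RestrictedProduct.flatten_equiv'_symm_apply] -/
@[simp]
lemma flatten_equiv'_symm_apply (x) (i : ι₂) (j : f ⁻¹' {i}) :
    (flattenEquiv' C hf).symm x i j = x j.1 :=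
  rfl

end flatten

section principal
/-!

## Principal filters

A restricted product over a principal filter is isomorphic to a product.

-/

variable {ι : Type*} (R : ι → Type*) (S : Set ι) [∀ i, Decidable (i ∈ S)] (A : (i : ι) → Set (R i))

open scoped Filter

section type

/-- The canonical isomorphism between `Πʳ i, [R i, A i]_[𝓟 S]` and
`(Π i ∈ S, R i) × (Π i ∉ S, A i)`
(In Mathlib's namespace `RestrictedProduct`: a deliberate extension under FLT's name, for dot
notation and so that the later packet files apply unchanged — CONVENTIONS §2.)
[cite: FLTProject2025, FLT/Mathlib/Topology/Algebra/RestrictedProduct/Equiv.lean · RestrictedProduct.principalEquivProd] -/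
def principalEquivProd : Πʳ i, [R i, A i]_[𝓟 S] ≃
    (Π i : S, A i) × (Π i : (Sᶜ : Set ι), R i) where
  toFun x := (fun i ↦ ⟨x i, x.2 i.2⟩, fun i ↦ x i)
  invFun y := ⟨fun i ↦ if hi : i ∈ S then y.1 ⟨i, hi⟩ else y.2 ⟨i, hi⟩,
  by aesop⟩
  left_inv x := by ext; simp
  right_inv x := by
    ext i
    · simp
    · simp [dif_neg i.2]

end type

variable {T : ι → Type*} [Π i, SetLike (T i) (R i)] {A : Π i, T i}

section monoid

-- TODO move to FLT/Mathlib
/-- Monoid equivalence version of `principalEquivProd`.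
(In Mathlib's namespace `RestrictedProduct`: a deliberate extension under FLT's name, for dot
notation and so that the later packet files apply unchanged — CONVENTIONS §2.)
[cite: FLTProject2025, FLT/Mathlib/Topology/Algebra/RestrictedProduct/Equiv.lean · RestrictedProduct.principalMulEquivProd] -/
@[to_additive /-- Additive monoid equivalence of principalEquivProd.
  (additive form; FLT's `RestrictedProduct.principalAddEquivSum`, same file) -/]
def principalMulEquivProd [Π i, Monoid (R i)] [∀ i, SubmonoidClass (T i) (R i)] :
    Πʳ i, [R i, A i]_[𝓟 S] ≃* (Π i : S, A i) × (Π i : (Sᶜ : Set ι), R i) where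
  __ := principalEquivProd R S _
  map_mul' _ _ := rfl

end monoid

variable {ι : Type*} (R : ι → Type*) {ℱ : Filter ι} (A : Type*) [CommRing A]

open scoped RestrictedProduct

open Filter

section module

/-- Module equivalence version of `principalEquivProd`.
(In Mathlib's namespace `RestrictedProduct`: a deliberate extension under FLT's name, for dot
notation and so that the later packet files apply unchanged — CONVENTIONS §2.)
[cite: FLTProject2025, FLT/Mathlib/Topology/Algebra/RestrictedProduct/Equiv.lean · RestrictedProduct.principalLinearEquivProd] -/
noncomputable def principalLinearEquivProd [Π i, AddCommGroup (R i)]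
    [∀ i, Module A (R i)] {C : ∀ i, Submodule A (R i)}
    (S : Set ι) [∀ i, Decidable (i ∈ S)] :
    (Πʳ i, [R i, C i]_[𝓟 S]) ≃ₗ[A] ((Π i : S, C i) ×
      (Π i : (Sᶜ : Set ι), R i)) where
  __ := principalAddEquivSum R S (A := C)
  map_smul' _ _ := rfl

end module

end principal

end RestrictedProduct

end

end
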